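import Literature.Geometry.DiscreteGeometry.KissingSearchCheck
import HarnessLib

/-!
# The growth search for the contact graphs of kissing configurations: definitions of the semantics

Topic `Literature/Geometry/DiscreteGeometry`; provefact brick for `Hales2012_contactGraphTame` /
`Hales2012_contactGraphFccOrHcp`.  This file collects the DEFINITIONS against which the soundness of
the checker `KissingSearchCheck.lean` is proved (the proofs are in `KissingSearchNumerics.lean`,
`KissingSearchStructure.lean`, `KissingSearchRules.lean`, `KissingSearchNode.lean`,
`KissingSearchRelabel.lean`, `KissingSearchSearch.lean`, `KissingSearchRoot.lean`, and the geometric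
dictionary in `KissingSearchGeometry.lean`):

* Part A — numeric semantics: `Encl` (a bracket code encloses an angle), `SymMem` (a real lies
  in the cell of a symbol), the circumradius polynomial `Pfun`, `pt3`, `symsList`, `ValidDom`;
* Part B — **the abstract structure `KConf`** (labels `< 12`, Gram entries, fan triangles, angles,
  and the local axioms of the fan-refined hull triangulation of a kissing configuration, all of
  which are PROVED for kissing configurations in `KissingSearchGeometry.lean`), its conclusion
  `KConf.Concl` (FCC or HCP contact graph by a bijection of labels, `tameAdjM 1 / 0`), triangle
  codes `TriValid / tset`, domain semantics `DomSem`, and **`Realizes M s`** (the state `s` of the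
  checker is consistent with `M`);
* Part C — auxiliary sets (`KConf.onSide`, `St.onSideL`, `KConf.sides`, `KConf.longSides`,
  `KConf.contacts`, `KConf.longSpokes`), the relabelling `KConf.relabel` of a structure by a
  permutation of the labels (with `KConf.concl_of_relabel`), label types `KConf.ty`, the root
  normalisation `KConf.RootInv`, the good root configuration `KConf.Good`, `trueCode`,
  `rootDomIdx`, `bitsOf`.

## References
* T. C. Hales, *A proof of Fejes Tóth's conjecture on sphere packings with kissing number
  twelve*, arXiv:1209.6043 (2012), Definition 1, Theorem 3, Lemmas 7–9. [`Hales2012`]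
* R. E. Moore, *Interval Analysis* (1966), Theorem 3.1. [`Moore1966`]
-/

namespace Literature.Geometry.DiscreteGeometry

namespace KissingSearch

open Real Literature.Analysis.ValidatedNumerics KissingLP NonemptyInterval Finset

/-! ### Part A. Numeric semantics -/

/-- **The enclosure relation**: the bracket `br` is feasible and `θ ∈ [brLo br · δ, brHi br · δ]`.
[folklore] -/
def Encl (br : ℕ) (θ : ℝ) : Prop :=
  br ≠ NOBR ∧ ((brLo br : ℝ) * δ ≤ θ ∧ θ ≤ (brHi br : ℝ) * δ)

/-- Membership of a real in the cell of a symbol. [folklore] -/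
def SymMem (σ : ℕ) (x : ℝ) : Prop := x ∈ (symIv σ).ratCast ℝ

/-- The circumradius polynomial as a real function. [folklore] -/
def Pfun (x y z : ℝ) : ℝ :=
  1 + 8 * x * y * z - 3 * (x ^ 2 + y ^ 2 + z ^ 2) + 2 * (x + y + z) - 2 * (x * y + x * z + y * z)

/-- The point of `ℕ → ℝ` carrying `(x, y, z)` in the coordinates `0, 1, 2` (and `z` beyond).
[folklore] -/
def pt3 (x y z : ℝ) : ℕ → ℝ := fun i => if i = 0 then x else if i = 1 then y else z

/-- The symbols of a domain code, as a list. [folklore] -/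
def symsList (r : ℕ) : List ℕ := if r = 0 then [0] else List.range' (rLo r) (rHi r + 1 - rLo r)

/-- A VALID domain code: the contact code `0`, or a cell range `1 ≤ lo ≤ hi ≤ K` in normal
form. [folklore] -/
def ValidDom (r : ℕ) : Prop := r = 0 ∨ (1 ≤ rLo r ∧ rLo r ≤ rHi r ∧ rHi r ≤ K ∧ r = mkR (rLo r) (rHi r))

/-! ### Part B. The abstract structure, its conclusion, codes, semantics, realized states -/

/-- `κ₀` as a real number. [cite: Hales2012, Definition 1] -/
noncomputable def κ0R : ℝ := ((κ0 : ℚ) : ℝ)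

/-- **The local structure of a labelled fan triangulation of a kissing configuration.**  Labels
are natural numbers `< 12`; `g a b` is the inner product of the unit vectors with labels `a, b`;
`T` is the set of fan triangles (three-element sets of labels); `ang t v` is the angle of the
triangle `t` at its vertex `v` (`0` if `v ∉ t`).  The fields after `ang` are the axioms used by
the search; all of them are proved for kissing configurations in `KissingSearchGeometry.lean`.
[cite: Hales2012, Definition 1 and proof of Theorem 3] -/
structure KConf where
  /-- Gram entries -/
  g : ℕ → ℕ → ℝ
  /-- fan triangles -/
  T : Finset (Finset ℕ)
  /-- angle of a triangle at a vertex -/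
  ang : Finset ℕ → ℕ → ℝ
  /-- symmetry of the Gram entries -/
  g_symm : ∀ a b, g a b = g b a
  /-- triangles are three labels `< 12` -/
  mem_T : ∀ t ∈ T, t.card = 3 ∧ ∀ a ∈ t, a < 12
  /-- twenty triangles -/
  card_T : T.card = 20
  /-- every side of a triangle lies in exactly two triangles -/
  two : ∀ t ∈ T, ∀ a ∈ t, ∀ b ∈ t, a ≠ b → (T.filter fun t' => a ∈ t' ∧ b ∈ t').card = 2
  /-- contacts are sides -/
  contact_side : ∀ a b, a < 12 → b < 12 → a ≠ b → g a b = 1 / 2 → ∃ t ∈ T, a ∈ t ∧ b ∈ t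
  /-- the gap: a pair is a contact or has inner product `≤ κ₀` (and `≥ -1`) -/
  dichot : ∀ a b, a < 12 → b < 12 → a ≠ b → g a b = 1 / 2 ∨ (-1 ≤ g a b ∧ g a b ≤ κ0R)
  /-- sides of triangles have inner product `> -1/2` -/
  side_bound : ∀ t ∈ T, ∀ a ∈ t, ∀ b ∈ t, a ≠ b → -(1 / 2 : ℝ) < g a b
  /-- at most four contacts at a label -/
  cdeg_le : ∀ a, a < 12 → ((range 12).filter fun b => b ≠ a ∧ g a b = 1 / 2).card ≤ 4
  /-- at least `23` contact pairs -/
  contacts_ge : 23 ≤ (((range 12) ×ˢ (range 12)).filter fun p => p.1 < p.2 ∧ g p.1 p.2 = 1 / 2).card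
  /-- node equation -/
  node : ∀ v, v < 12 → ∑ t ∈ T, ang t v = 2 * π
  /-- angles are nonnegative -/
  ang_nonneg : ∀ t v, 0 ≤ ang t v
  /-- angles are at most `π` -/
  ang_le_pi : ∀ t v, ang t v ≤ π
  /-- the angle of a triangle at a non-vertex is `0` -/
  ang_zero : ∀ t ∈ T, ∀ v, v ∉ t → ang t v = 0
  /-- spherical law of cosines -/
  cos_law : ∀ t ∈ T, ∀ v ∈ t, ∀ a ∈ t, ∀ b ∈ t, v ≠ a → v ≠ b → a ≠ b →
    Real.cos (ang t v) * (Real.sqrt (1 - g v a ^ 2) * Real.sqrt (1 - g v b ^ 2)) = g a b - g v a * g v b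
  /-- circumradius `< 60°` in polynomial form -/
  circum : ∀ t ∈ T, ∀ v ∈ t, ∀ a ∈ t, ∀ b ∈ t, v ≠ a → v ≠ b → a ≠ b → 0 < Pfun (g v a) (g v b) (g a b)
  /-- the rhombus cap -/
  pairing : ∀ p q v w, p ≠ q → v ≠ w → ({p, q, v} : Finset ℕ) ∈ T → ({p, q, w} : Finset ℕ) ∈ T →
    g v p = 1 / 2 → g v q = 1 / 2 → g w p = 1 / 2 → g w q = 1 / 2 → 0 ≤ g p q
  /-- the link of a label is a single cycle (closure form) -/
  link : ∀ v, v < 12 → ∀ A ⊆ T.filter (fun t => v ∈ t), A.Nonempty →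
    (∀ t ∈ A, ∀ t' ∈ T, v ∈ t' → (t ∩ t').card = 2 → t' ∈ A) → A = T.filter fun t => v ∈ t
  /-- the triangles connect the labels -/
  conn : ∀ D ⊆ range 12, D.Nonempty → (∀ t ∈ T, (∃ a ∈ t, a ∈ D) → t ⊆ D) → D = range 12
  /-- every label is a vertex of a triangle -/
  cover : ∀ v, v < 12 → ∃ t ∈ T, v ∈ t

/-- **The conclusion**: the contact graph of `M` is, by a bijection of the labels, the FCC
(`tameAdjM 1`) or the HCP (`tameAdjM 0`) contact graph. [cite: Hales2012, Lemma 9] -/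
def KConf.Concl (M : KConf) : Prop :=
  ∃ i : Fin 8, (i = 0 ∨ i = 1) ∧ ∃ e : Fin 12 ≃ Fin 12,
    ∀ a b : Fin 12, ((a : ℕ) ≠ b ∧ M.g a b = 1 / 2) ↔ tameAdjM i (e a) (e b) = true

/-- A VALID triangle code: strictly increasing vertices `< 12`, and the code is their
`triCode`. [folklore] -/
def TriValid (t : ℕ) : Prop := tv0 t < tv1 t ∧ tv1 t < tv2 t ∧ tv2 t < 12 ∧ t = triCode (tv0 t) (tv1 t) (tv2 t)

/-- The vertex set of a triangle code. [folklore] -/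
def tset (t : ℕ) : Finset ℕ := {tv0 t, tv1 t, tv2 t}

/-- **Meaning of a domain code** for the Gram entry `x` of its side: unlabelled (no
information), contact (`x = 1/2`), or a valid cell range enclosing `x ≠ 1/2`. [folklore] -/
def DomSem (r : ℕ) (x : ℝ) : Prop :=
  r = UNL ∨ (r = 0 ∧ x = 1 / 2) ∨
    (ValidDom r ∧ r ≠ 0 ∧ x ≠ 1 / 2 ∧ ((gridPt (rLo r - 1) : ℚ) : ℝ) ≤ x ∧ x ≤ ((gridPt (rHi r) : ℚ) : ℝ))

/-- **A state realized by a structure.**  The placed triangles are valid codes of triangles of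
`M` without repetition; the side counts are the true counts; every domain code is valid and
means what it says about the Gram entry; labelled sides are sides of placed triangles and
conversely. [folklore] -/
structure Realizes (M : KConf) (s : St) : Prop where
  /-- the domain array has `144` entries -/
  size_dom : s.dom.size = 144
  /-- the side-count array has `144` entries -/
  size_sc : s.sc.size = 144
  /-- placed triangles are valid codes -/
  valid : ∀ t ∈ s.tris.toList, TriValid t
  /-- placed triangles are triangles of `M` -/
  mem : ∀ t ∈ s.tris.toList, tset t ∈ M.T
  /-- no repetition -/
  nodup : s.tris.toList.Nodup
  /-- the cached side counts are the true counts -/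
  sc_eq : ∀ a b, a < 12 → b < 12 → a ≠ b →
    s.gsc a b = (s.tris.toList.filter fun t => tmem t a && tmem t b).length
  /-- domain codes mean what they say -/
  dom : ∀ a b, a < 12 → b < 12 → a ≠ b → DomSem (s.gdom a b) (M.g a b)
  /-- labelled pairs are sides of placed triangles -/
  lab_side : ∀ a b, a < 12 → b < 12 → a ≠ b → s.gdom a b ≠ UNL →
    ∃ t ∈ s.tris.toList, a ∈ tset t ∧ b ∈ tset t
  /-- sides of placed triangles are labelled -/
  side_lab : ∀ t ∈ s.tris.toList, ∀ a ∈ tset t, ∀ b ∈ tset t, a ≠ b → s.gdom a b ≠ UNL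

/-! ### Part C. Auxiliary sets, relabelling, root normalisation -/

/-- The set of `M`-triangles through two labels. [folklore] -/
def KConf.onSide (M : KConf) (v x : ℕ) : Finset (Finset ℕ) := M.T.filter fun t => v ∈ t ∧ x ∈ t

/-- The placed triangles through two labels. [folklore] -/
def St.onSideL (s : St) (v x : ℕ) : List ℕ := s.tris.toList.filter fun t => tmem t v && tmem t x

/-- The sides of the triangles of `M` (two-element subsets). [folklore] -/
def KConf.sides (M : KConf) : Finset (Finset ℕ) := M.T.biUnion fun t => t.powersetCard 2

/-- The long sides (not contacts). [folklore] -/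
noncomputable def KConf.longSides (M : KConf) : Finset (Finset ℕ) := M.sides.filter fun e => ∃ p ∈ e, ∃ q ∈ e, p ≠ q ∧ M.g p q ≠ 1 / 2

/-- The type of a pair in `M`: `0` for a contact, `1` otherwise. [folklore] -/
noncomputable def KConf.ty (M : KConf) (p q : ℕ) : ℕ := if M.g p q = 1 / 2 then 0 else 1

/-- **The root normalisation** carried along the search: label `0` has exactly four contacts,
at most one long side of the triangulation, and the reflection tie-break
`(ty 0 3, ty 1 3) ≤ (ty 0 4, ty 2 4)` holds. [folklore] -/
def KConf.RootInv (M : KConf) : Prop :=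
  ((Finset.range 12).filter fun u => u ≠ 0 ∧ M.g 0 u = 1 / 2).card = 4 ∧
  (∀ u w, ({0, u} : Finset ℕ) ∈ M.longSides → ({0, w} : Finset ℕ) ∈ M.longSides → u = w) ∧
  ¬ (M.ty 0 4 < M.ty 0 3 ∨ (M.ty 0 3 = M.ty 0 4 ∧ M.ty 2 4 < M.ty 1 3))

/-- The true code of a pair: its present code if labelled, else contact or the full long range
according to `M`. [folklore] -/
noncomputable def trueCode (M : KConf) (s : St) (p q : ℕ) : ℕ :=
  if s.gdom p q ≠ UNL then s.gdom p q else if M.g p q = 1 / 2 then 0 else FULLR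

/-- The contacts of a label. [folklore] -/
noncomputable def KConf.contacts (M : KConf) (v : ℕ) : Finset ℕ := (Finset.range 12).filter fun u => u ≠ v ∧ M.g v u = 1 / 2

/-- The long sides through a label (as the other endpoint). [folklore] -/
noncomputable def KConf.longSpokes (M : KConf) (v : ℕ) : Finset ℕ := (Finset.range 12).filter fun u => ({v, u} : Finset ℕ) ∈ M.longSides

/-- **The good configuration at a root vertex**: the root `v₀`, a triangle `{v₀, p, q}` with two
contact spokes, and the further triangles `{v₀, p, p₃}`, `{v₀, q, p₄}` (`p₃ ≠ p₄`), with the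
four-contacts and one-long-side conditions at `v₀`. [folklore] -/
def KConf.Good (M : KConf) (v₀ p q p₃ p₄ : ℕ) : Prop :=
  v₀ < 12 ∧ p < 12 ∧ q < 12 ∧ p₃ < 12 ∧ p₄ < 12 ∧
  v₀ ≠ p ∧ v₀ ≠ q ∧ v₀ ≠ p₃ ∧ v₀ ≠ p₄ ∧ p ≠ q ∧ p ≠ p₃ ∧ p ≠ p₄ ∧ q ≠ p₃ ∧ q ≠ p₄ ∧ p₃ ≠ p₄ ∧
  M.g v₀ p = 1 / 2 ∧ M.g v₀ q = 1 / 2 ∧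
  ({v₀, p, q} : Finset ℕ) ∈ M.T ∧ ({v₀, p, p₃} : Finset ℕ) ∈ M.T ∧ ({v₀, q, p₄} : Finset ℕ) ∈ M.T ∧
  (M.contacts v₀).card = 4 ∧ (∀ u w, ({v₀, u} : Finset ℕ) ∈ M.longSides → ({v₀, w} : Finset ℕ) ∈ M.longSides → u = w)

/-- The root domains by side index (specification of `mkRoot`). [folklore] -/
def rootDomIdx (m bits i : ℕ) : ℕ :=
  let lab : ℕ → ℕ := fun t => if t = 0 then 0 else FULLR
  if i = sIdx 0 1 then 0 else if i = sIdx 0 2 then 0 else if i = sIdx 1 2 then lab m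
  else if i = sIdx 0 3 then lab (bits % 2) else if i = sIdx 1 3 then lab ((bits / 2) % 2)
  else if i = sIdx 0 4 then lab ((bits / 4) % 2) else if i = sIdx 2 4 then lab ((bits / 8) % 2) else UNL

/-- The type bits read off `M`. [folklore] -/
noncomputable def bitsOf (M : KConf) : ℕ := M.ty 0 3 + 2 * M.ty 1 3 + 4 * M.ty 0 4 + 8 * M.ty 2 4

/-! #### Relabelling -/

section Relabel

variable (M : KConf) (σ : Equiv.Perm ℕ) (hσ : ∀ a, σ a < 12 ↔ a < 12)

/-- Image of a label set under the permutation. [folklore] -/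
def relab (σ : Equiv.Perm ℕ) (t : Finset ℕ) : Finset ℕ := t.image σ

/-- `relab` by `σ⁻¹` undoes `relab` by `σ`. [folklore] -/
theorem relab_symm_relab (t : Finset ℕ) : relab σ.symm (relab σ t) = t := by
  unfold relab; rw [Finset.image_image]; simp

/-- `relab` by `σ` undoes `relab` by `σ⁻¹`. [folklore] -/
theorem relab_relab_symm (t : Finset ℕ) : relab σ (relab σ.symm t) = t := by
  unfold relab; rw [Finset.image_image]; simp

/-- `relab` is injective. [folklore] -/
theorem relab_injective : Function.Injective (relab σ) := fun t t' h => by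
  have := congrArg (relab σ.symm) h
  rwa [relab_symm_relab, relab_symm_relab] at this

/-- Membership in a relabelled set. [folklore] -/
theorem mem_relab_iff {t : Finset ℕ} {a : ℕ} : a ∈ relab σ t ↔ σ.symm a ∈ t := by
  unfold relab
  rw [Finset.mem_image]
  constructor
  · rintro ⟨b, hb, rfl⟩; simpa using hb
  · intro h; exact ⟨σ.symm a, h, by simp⟩

/-- Cardinality is preserved. [folklore] -/
theorem card_relab (t : Finset ℕ) : (relab σ t).card = t.card := by
  unfold relab; exact Finset.card_image_of_injective _ σ.injective

include hσ in
/-- The inverse permutation also preserves `[0, 12)`. [folklore] -/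
theorem symm_lt_iff (a : ℕ) : σ.symm a < 12 ↔ a < 12 := by
  have := hσ (σ.symm a); simp at this; exact this.symm

include hσ in
/-- **The relabelled structure.** [folklore] -/
def KConf.relabel : KConf where
  g := fun a b => M.g (σ.symm a) (σ.symm b)
  T := M.T.image (relab σ)
  ang := fun t v => M.ang (relab σ.symm t) (σ.symm v)
  g_symm := fun a b => M.g_symm _ _
  mem_T := by
    intro t ht
    rw [Finset.mem_image] at ht
    obtain ⟨t₀, ht₀, rfl⟩ := ht
    obtain ⟨hc, hl⟩ := M.mem_T t₀ ht₀
    refine ⟨by rw [card_relab, hc], fun a ha => ?_⟩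
    rw [mem_relab_iff] at ha
    have := hl _ ha
    rwa [symm_lt_iff σ hσ] at this
  card_T := by rw [Finset.card_image_of_injective _ (relab_injective σ), M.card_T]
  two := by
    intro t ht a ha b hb hab
    rw [Finset.mem_image] at ht
    obtain ⟨t₀, ht₀, rfl⟩ := ht
    rw [mem_relab_iff] at ha hb
    have h := M.two t₀ ht₀ _ ha _ hb (fun e => hab (σ.symm.injective e))
    rw [← h]
    -- the filter on the image is the image of the filter
    have : (M.T.image (relab σ)).filter (fun t' => a ∈ t' ∧ b ∈ t') =
        (M.T.filter fun t' => σ.symm a ∈ t' ∧ σ.symm b ∈ t').image (relab σ) := by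
      ext t'
      simp only [Finset.mem_filter, Finset.mem_image]
      constructor
      · rintro ⟨⟨t₁, ht₁, rfl⟩, ha', hb'⟩
        rw [mem_relab_iff] at ha' hb'
        exact ⟨t₁, ⟨ht₁, ha', hb'⟩, rfl⟩
      · rintro ⟨t₁, ⟨ht₁, ha', hb'⟩, rfl⟩
        exact ⟨⟨t₁, ht₁, rfl⟩, (mem_relab_iff σ).2 ha', (mem_relab_iff σ).2 hb'⟩
    rw [this, Finset.card_image_of_injective _ (relab_injective σ)]
  contact_side := by
    intro a b ha hb hab hg
    obtain ⟨t, ht, hat, hbt⟩ := M.contact_side _ _ ((symm_lt_iff σ hσ a).2 ha) ((symm_lt_iff σ hσ b).2 hb)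
      (fun e => hab (σ.symm.injective e)) hg
    exact ⟨relab σ t, Finset.mem_image_of_mem _ ht, (mem_relab_iff σ).2 hat, (mem_relab_iff σ).2 hbt⟩
  dichot := fun a b ha hb hab => M.dichot _ _ ((symm_lt_iff σ hσ a).2 ha) ((symm_lt_iff σ hσ b).2 hb)
    (fun e => hab (σ.symm.injective e))
  side_bound := by
    intro t ht a ha b hb hab
    rw [Finset.mem_image] at ht
    obtain ⟨t₀, ht₀, rfl⟩ := ht
    rw [mem_relab_iff] at ha hb
    exact M.side_bound t₀ ht₀ _ ha _ hb (fun e => hab (σ.symm.injective e))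
  cdeg_le := by
    intro a ha
    have h := M.cdeg_le (σ.symm a) ((symm_lt_iff σ hσ a).2 ha)
    refine le_trans (le_of_eq ?_) h
    refine Finset.card_bij (fun b _ => σ.symm b) ?_ ?_ ?_
    · intro b hb
      simp only [Finset.mem_filter, Finset.mem_range] at hb ⊢
      exact ⟨(symm_lt_iff σ hσ b).2 hb.1, fun e => hb.2.1 (σ.symm.injective e), hb.2.2⟩
    · intro b _ b' _ e; exact σ.symm.injective e
    · intro c hc
      simp only [Finset.mem_filter, Finset.mem_range] at hc
      refine ⟨σ c, ?_, by simp⟩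
      simp only [Finset.mem_filter, Finset.mem_range]
      refine ⟨(hσ c).2 hc.1, fun e => hc.2.1 ?_, by simpa using hc.2.2⟩
      have := congrArg σ.symm e; simpa using this
  contacts_ge := by
    refine le_trans M.contacts_ge (le_of_eq ?_)
    symm
    -- bijection on pairs: (p, q) ↦ sorted (σ⁻¹ p, σ⁻¹ q)
    refine Finset.card_bij (fun p _ => (min (σ.symm p.1) (σ.symm p.2), max (σ.symm p.1) (σ.symm p.2))) ?_ ?_ ?_
    · intro p hp
      simp only [Finset.mem_filter, Finset.mem_product, Finset.mem_range] at hp ⊢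
      obtain ⟨⟨h1, h2⟩, hlt, hg⟩ := hp
      have h1' := (symm_lt_iff σ hσ p.1).2 h1
      have h2' := (symm_lt_iff σ hσ p.2).2 h2
      have hne : σ.symm p.1 ≠ σ.symm p.2 := fun e => (ne_of_lt hlt) (σ.symm.injective e)
      refine ⟨⟨by omega, by omega⟩, by omega, ?_⟩
      rcases le_total (σ.symm p.1) (σ.symm p.2) with h | h
      · rw [min_eq_left h, max_eq_right h]; exact hg
      · rw [min_eq_right h, max_eq_left h, M.g_symm]; exact hg
    · intro p hp p' hp' e
      simp only [Finset.mem_filter, Finset.mem_product, Finset.mem_range] at hp hp'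
      simp only [Prod.mk.injEq] at e
      obtain ⟨e1, e2⟩ := e
      -- {σ⁻¹ p.1, σ⁻¹ p.2} = {σ⁻¹ p'.1, σ⁻¹ p'.2} as unordered pairs, with p.1 < p.2, p'.1 < p'.2
      have key : (σ.symm p.1 = σ.symm p'.1 ∧ σ.symm p.2 = σ.symm p'.2) ∨
          (σ.symm p.1 = σ.symm p'.2 ∧ σ.symm p.2 = σ.symm p'.1) := by
        rcases le_total (σ.symm p.1) (σ.symm p.2) with h | h <;>
          rcases le_total (σ.symm p'.1) (σ.symm p'.2) with h' | h'
        · rw [min_eq_left h, min_eq_left h'] at e1; rw [max_eq_right h, max_eq_right h'] at e2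
          exact Or.inl ⟨e1, e2⟩
        · rw [min_eq_left h, min_eq_right h'] at e1; rw [max_eq_right h, max_eq_left h'] at e2
          exact Or.inr ⟨e1, e2⟩
        · rw [min_eq_right h, min_eq_left h'] at e1; rw [max_eq_left h, max_eq_right h'] at e2
          exact Or.inr ⟨e2, e1⟩
        · rw [min_eq_right h, min_eq_right h'] at e1; rw [max_eq_left h, max_eq_left h'] at e2
          exact Or.inl ⟨e2, e1⟩
      rcases key with ⟨k1, k2⟩ | ⟨k1, k2⟩
      · exact Prod.ext (σ.symm.injective k1) (σ.symm.injective k2)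
      · exfalso
        have a1 := σ.symm.injective k1
        have a2 := σ.symm.injective k2
        have := hp.2.1; have := hp'.2.1
        omega
    · intro q hq
      simp only [Finset.mem_filter, Finset.mem_product, Finset.mem_range] at hq
      obtain ⟨⟨h1, h2⟩, hlt, hg⟩ := hq
      refine ⟨(min (σ q.1) (σ q.2), max (σ q.1) (σ q.2)), ?_, ?_⟩
      · simp only [Finset.mem_filter, Finset.mem_product, Finset.mem_range]
        have h1' := (hσ q.1).2 h1
        have h2' := (hσ q.2).2 h2
        have hne : σ q.1 ≠ σ q.2 := fun e => (ne_of_lt hlt) (σ.injective e)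
        refine ⟨⟨by omega, by omega⟩, by omega, ?_⟩
        rcases le_total (σ q.1) (σ q.2) with h | h
        · rw [min_eq_left h, max_eq_right h]; simpa using hg
        · rw [min_eq_right h, max_eq_left h]; simp only [Equiv.symm_apply_apply]; rw [M.g_symm]; exact hg
      · rcases le_total (σ q.1) (σ q.2) with h | h
        · rw [min_eq_left h, max_eq_right h]; simp only [Equiv.symm_apply_apply]
          rw [min_eq_left hlt.le, max_eq_right hlt.le]
        · rw [min_eq_right h, max_eq_left h]; simp only [Equiv.symm_apply_apply]
          rw [min_eq_right hlt.le, max_eq_left hlt.le]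
          -- then σ q.2 ≤ σ q.1 and q.1 < q.2: the pair is (q.1, q.2) anyway
  node := by
    intro v hv
    have h := M.node (σ.symm v) ((symm_lt_iff σ hσ v).2 hv)
    rw [Finset.sum_image fun t _ t' _ e => relab_injective σ e]
    simp only [relab_symm_relab]
    exact h
  ang_nonneg := fun t v => M.ang_nonneg _ _
  ang_le_pi := fun t v => M.ang_le_pi _ _
  ang_zero := by
    intro t ht v hv
    rw [Finset.mem_image] at ht
    obtain ⟨t₀, ht₀, rfl⟩ := ht
    rw [relab_symm_relab]
    exact M.ang_zero t₀ ht₀ _ (fun h => hv ((mem_relab_iff σ).2 h))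
  cos_law := by
    intro t ht v hv a ha b hb hva hvb hab
    rw [Finset.mem_image] at ht
    obtain ⟨t₀, ht₀, rfl⟩ := ht
    rw [mem_relab_iff] at hv ha hb
    rw [relab_symm_relab]
    exact M.cos_law t₀ ht₀ _ hv _ ha _ hb (fun e => hva (σ.symm.injective e)) (fun e => hvb (σ.symm.injective e))
      (fun e => hab (σ.symm.injective e))
  circum := by
    intro t ht v hv a ha b hb hva hvb hab
    rw [Finset.mem_image] at ht
    obtain ⟨t₀, ht₀, rfl⟩ := ht
    rw [mem_relab_iff] at hv ha hb
    exact M.circum t₀ ht₀ _ hv _ ha _ hb (fun e => hva (σ.symm.injective e)) (fun e => hvb (σ.symm.injective e))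
      (fun e => hab (σ.symm.injective e))
  pairing := by
    intro p q v w hpq hvw h1 h2 g1 g2 g3 g4
    have img : ∀ {x y z : ℕ}, ({x, y, z} : Finset ℕ) ∈ M.T.image (relab σ) →
        ({σ.symm x, σ.symm y, σ.symm z} : Finset ℕ) ∈ M.T := by
      intro x y z h
      rw [Finset.mem_image] at h
      obtain ⟨t₀, ht₀, e⟩ := h
      have : relab σ.symm (relab σ t₀) = relab σ.symm {x, y, z} := by rw [e]
      rw [relab_symm_relab] at this
      rw [this] at ht₀
      unfold relab at ht₀
      simpa [Finset.image_insert, Finset.image_singleton] using ht₀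
    exact M.pairing _ _ _ _ (fun e => hpq (σ.symm.injective e)) (fun e => hvw (σ.symm.injective e)) (img h1) (img h2)
      g1 g2 g3 g4
  link := by
    intro v hv A hA hAne hcl
    -- pull back `A`
    set A₀ := A.image (relab σ.symm) with hA₀
    have hv₀ : σ.symm v < 12 := (symm_lt_iff σ hσ v).2 hv
    have hA₀sub : A₀ ⊆ M.T.filter fun t => σ.symm v ∈ t := by
      intro t ht
      rw [hA₀, Finset.mem_image] at ht
      obtain ⟨t', ht', rfl⟩ := ht
      have := hA ht'
      rw [Finset.mem_filter, Finset.mem_image] at this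
      obtain ⟨⟨t₀, ht₀, rfl⟩, hv'⟩ := this
      rw [Finset.mem_filter, relab_symm_relab]
      exact ⟨ht₀, (mem_relab_iff σ).1 hv'⟩
    have hA₀ne : A₀.Nonempty := by rw [hA₀]; exact hAne.image _
    have hcl₀ : ∀ t ∈ A₀, ∀ t' ∈ M.T, σ.symm v ∈ t' → (t ∩ t').card = 2 → t' ∈ A₀ := by
      intro t ht t' ht' hvt' h2
      rw [hA₀, Finset.mem_image] at ht
      obtain ⟨t₁, ht₁, rfl⟩ := ht
      have h := hcl t₁ ht₁ (relab σ t') (Finset.mem_image_of_mem _ ht') ((mem_relab_iff σ).2 hvt') ?_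
      · rw [hA₀, Finset.mem_image]; exact ⟨relab σ t', h, relab_symm_relab σ t'⟩
      · -- intersections correspond
        have : relab σ.symm t₁ ∩ t' = relab σ.symm (t₁ ∩ relab σ t') := by
          unfold relab
          ext x
          simp only [Finset.mem_inter, Finset.mem_image]
          constructor
          · rintro ⟨⟨y, hy, rfl⟩, hx⟩
            exact ⟨y, ⟨hy, σ.symm y, hx, by simp⟩, rfl⟩
          · rintro ⟨y, ⟨hy, z, hz, hzy⟩, rfl⟩
            refine ⟨⟨y, hy, rfl⟩, ?_⟩
            rw [← hzy]; simpa using hz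
        rw [this] at h2
        unfold relab at h2 ⊢
        rwa [Finset.card_image_of_injective _ σ.symm.injective] at h2
    have heq := M.link _ hv₀ A₀ hA₀sub hA₀ne hcl₀
    -- push forward
    ext t'
    constructor
    · exact fun h => hA h
    · intro ht'
      rw [Finset.mem_filter, Finset.mem_image] at ht'
      obtain ⟨⟨t₀, ht₀, rfl⟩, hv'⟩ := ht'
      have : t₀ ∈ A₀ := by rw [heq, Finset.mem_filter]; exact ⟨ht₀, (mem_relab_iff σ).1 hv'⟩
      rw [hA₀, Finset.mem_image] at this
      obtain ⟨t₁, ht₁, e⟩ := this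
      have : relab σ (relab σ.symm t₁) = relab σ t₀ := by rw [e]
      rw [relab_relab_symm] at this
      rw [← this]; exact ht₁
  conn := by
    intro D hD hDne hcl
    set D₀ := D.image σ.symm with hD₀
    have hD₀sub : D₀ ⊆ Finset.range 12 := by
      intro a ha
      rw [hD₀, Finset.mem_image] at ha
      obtain ⟨b, hb, rfl⟩ := ha
      rw [Finset.mem_range, symm_lt_iff σ hσ]
      exact Finset.mem_range.1 (hD hb)
    have hD₀ne : D₀.Nonempty := by rw [hD₀]; exact hDne.image _
    have hcl₀ : ∀ t ∈ M.T, (∃ a ∈ t, a ∈ D₀) → t ⊆ D₀ := by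
      intro t ht ⟨a, hat, haD⟩
      rw [hD₀, Finset.mem_image] at haD
      obtain ⟨b, hb, hba⟩ := haD
      have h := hcl (relab σ t) (Finset.mem_image_of_mem _ ht) ⟨b, (mem_relab_iff σ).2 (by rw [hba]; exact hat), hb⟩
      intro x hx
      rw [hD₀, Finset.mem_image]
      exact ⟨σ x, h ((mem_relab_iff σ).2 (by simpa using hx)), by simp⟩
    have heq := M.conn D₀ hD₀sub hD₀ne hcl₀
    ext a
    constructor
    · exact fun h => hD h
    · intro ha
      rw [Finset.mem_range] at ha
      have : σ.symm a ∈ D₀ := by rw [heq, Finset.mem_range, symm_lt_iff σ hσ]; exact ha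
      rw [hD₀, Finset.mem_image] at this
      obtain ⟨b, hb, e⟩ := this
      rw [σ.symm.injective e] at hb  -- e : σ.symm b = σ.symm a
      exact hb
  cover := by
    intro v hv
    obtain ⟨t, ht, hvt⟩ := M.cover _ ((symm_lt_iff σ hσ v).2 hv)
    exact ⟨relab σ t, Finset.mem_image_of_mem _ ht, (mem_relab_iff σ).2 hvt⟩

include hσ in
/-- **The conclusion is invariant under relabelling.** [folklore] -/
theorem KConf.concl_of_relabel (h : (M.relabel σ hσ).Concl) : M.Concl := by
  obtain ⟨i, hi, e, he⟩ := h
  -- σ restricted to `Fin 12`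
  let τ : Fin 12 → Fin 12 := fun a => ⟨σ a, (hσ a).2 a.2⟩
  have hτ : Function.Injective τ := fun a b h => by
    have : σ a = σ b := by simpa [τ] using congrArg Fin.val h
    exact Fin.ext (σ.injective this)
  have hτb : Function.Bijective τ := (Finite.injective_iff_bijective).1 hτ
  let τe : Fin 12 ≃ Fin 12 := Equiv.ofBijective τ hτb
  refine ⟨i, hi, τe.trans e, fun a b => ?_⟩
  have h := he (τe a) (τe b)
  simp only [Equiv.trans_apply]
  rw [← h]
  have hg : (M.relabel σ hσ).g (τe a) (τe b) = M.g a b := by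
    show M.g (σ.symm (σ a)) (σ.symm (σ b)) = M.g a b; simp
  have hne : ((τe a : Fin 12) : ℕ) ≠ (τe b : ℕ) ↔ (a : ℕ) ≠ b := by
    show σ a ≠ σ b ↔ (a : ℕ) ≠ b; exact σ.injective.ne_iff
  rw [hg, hne]

end Relabel

end KissingSearch

end Literature.Geometry.DiscreteGeometry
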